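import Summits.CriticalPhenomena.PercolationContinuityZ3.Theorems.PercNearOneGluingNoHeavyQuantScaleDefect
import Literature.Barriers.CriticalPhenomena.SpanningClustersAboveSixProofs
import HarnessLib

/-!
# PAPER-2 track, ARM-3 (gen 2): the bounded-aspect crossing defect `X_B(λ)` FAILS above six dimensions at aspect THREE as well
# (Aizenman 1997, Thm. 4 (1), by a translation; kernel)

builds on p205010 (kernel theorem, internal audit signed; external expert review pending).

Seat `prim-quant-arm-3` gen 2 (memo `run/shared/lean/prim/quant/prim-quant-arm-3/POWERLAW-SURVEY.md` §9; paper-2 draft §6.3 "Power laws").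
Route (B) of the survey consumes the defect `Quant.ScaleDefectAt d p_c (λ·) η` (Question q:bounded-aspect of the paper-2 draft).  The barrier file
`SpanningClustersAboveSix.lean` proves its failure above six dimensions (under `TwoPointBoundedRatio d`, Aizenman's (t-c) with `η = 0`) at aspect
`λ = 2` only (`SpanningClustersAboveSix.not_annulusCrossing_bounded_away_from_one`, translation of a bulk spanning of `Λ_n` by `n e₁`).  The draft
§6.3 remarks that "aspect ratio 3 is still within reach of part (1), by a translation; larger aspect ratios are not reproduced in the development".
This proof-only file supplies aspect three: the box `Λ_n + 2n e₁ = [n, 3n] × [-n, n]^{d-1}` has its left face `{x₁ = n}` inside `Λ_n` and its right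
face `{x₁ = 3n}` on `∂ⁱⁿΛ_{3n}`, so a bulk left–right spanning path of `Λ_n`, translated by `2n e₁` and stopped at its first visit to `∂ⁱⁿΛ_{3n}`, is an
annulus crossing `Λ_n ↔ ∂ⁱⁿΛ_{3n}` inside `Λ_{3n}` (for configurations on the edges of `ℤ^d`, an almost sure event).

* `Quant.real_bulkSpanning_le_real_boxCrossing`: `P_p(Λ_n spanned, bulk b.c.) ≤ P_p(boxCrossing d n ((k+1)n))` for `k ≤ 2` (the shift `k n e₁`; `k = 1` is the
  barrier file's statement in the `linked`/`boxCrossing` vocabulary of the lane);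
* `Quant.boxCrossing_tendsto_one_of_six_lt`: `6 < d`, `TwoPointBoundedRatio d` ⟹ `P_{p_c}(boxCrossing d n ((k+1)n)) → 1` (`k ≤ 2`), by the kernel theorem
  `SpanningClustersAboveSix_holds` (Aizenman 1997, Thm. 4 (1));
* `Quant.not_scaleDefectAt_of_six_lt`: **`¬ ScaleDefectAt d p_c ((k+1)·) η` for every `η > 0`, `k ∈ {1, 2}`** — the defect of route (B) fails above six
  dimensions at aspects `2` AND `3`; `not_scaleDefectAt_three_of_six_lt` / `_two_` are the named instances.  Aspect `≥ 4` needs part (2) of Aizenman's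
  Thm. 4 (spanning clusters visible in windows), which is not in the tree.

Conditional on `TwoPointBoundedRatio d` (a theorem for `d ≥ 11` granted `Hara2008_etaZeroXSpace`, expected for all `d > 6`).  Proof-only; nothing here is a
rate for `d = 3`; the point is barrier placement (D-0021/BC8) for the paper's Question q:bounded-aspect at `λ = 3`.
-/

noncomputable section

namespace Summit.CriticalPhenomena.PercolationContinuityZ3.Theorems.Quant

open MeasureTheory Filter Topology Literature.Probability.Percolation Literature.Probability.LatticeModels
open Summit.CriticalPhenomena.PercolationContinuityZ3.Theorems.SurfaceTension
open Literature.Barriers.CriticalPhenomena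

variable {d : ℕ}

/-! ### Aspect three above six dimensions: BCKS's own rectangles -/

/-- Translating the left face `∂Λ_-` of `Λ_n` by `k n e₁` with `k ≤ 2` lands in `Λ_n`. [folklore] -/
theorem add_single_mul_mem_box_of_mem_leftFace [NeZero d] {n k : ℕ} (hk : k ≤ 2) {x : Site d} (hx : x ∈ leftFace d n) :
    x + Pi.single 0 ((k * n : ℕ) : ℤ) ∈ box d n := by
  obtain ⟨hxb, hx0⟩ := hx
  rw [mem_box] at hxb ⊢
  intro i
  by_cases hi : i = 0
  · subst hi
    simp only [Pi.add_apply, hx0, Pi.single_eq_same]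
    push_cast
    constructor <;> nlinarith
  · have := hxb i; simp [Pi.single_eq_of_ne hi, this]

/-- Translating the right face `∂Λ_+` of `Λ_n` by `k n e₁` lands on the face `{x₁ = (k+1) n}` of `∂ⁱⁿΛ_{(k+1)n}`. [folklore] -/
theorem add_single_mul_mem_innerBoundary_of_mem_rightFace [NeZero d] {n k : ℕ} {y : Site d} (hy : y ∈ rightFace d n) :
    y + Pi.single 0 ((k * n : ℕ) : ℤ) ∈ innerBoundary (zdGraph d) (box d ((k + 1) * n)) := by
  obtain ⟨hyb, hy0⟩ := hy
  rw [mem_box] at hyb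
  refine DCT16.mem_innerBoundary_box_of_natAbs_eq ?_ (i := 0) ?_
  · rw [mem_box]
    intro i
    by_cases hi : i = 0
    · subst hi; simp [hy0]; constructor <;> nlinarith
    · have := hyb i; simp [Pi.single_eq_of_ne hi]; constructor <;> nlinarith
  · have h0 : (y + Pi.single (0 : Fin d) ((k * n : ℕ) : ℤ) : Site d) 0 = (((k + 1) * n : ℕ) : ℤ) := by
      rw [Pi.add_apply, Pi.single_eq_same, hy0]; push_cast; ring
    rw [h0, Int.natAbs_natCast]

/-- **Bulk spanning of `Λ_n`, translated by `k n e₁` (`1 ≤ k ≤ 2`), crosses the annulus `Λ_{(k+1)n} ∖ Λ_n` inside `Λ_{(k+1)n}`**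
(first-exit argument, as in the barrier file's aspect-two `relabel_shift_mem_annulusCrossing`). [cite: Aizenman1997, Thm. 4 (1)] -/
theorem relabel_shift_mem_cross [NeZero d] {n k : ℕ} (hk : k ≤ 2) {ω : BondConfig (Site d)}
    (hωE : ω ⊆ (zdGraph d).edgeSet) (hω : ω ∈ bulkSpanning d n) :
    BondConfig.relabel (sym2Equiv (Site.shift (Pi.single 0 ((k * n : ℕ) : ℤ)))) ω ∈
      {ω : BondConfig (Site d) | ∃ x ∈ box d n, ∃ y ∈ innerBoundary (zdGraph d) (box d ((k + 1) * n)),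
        ω ∈ openConnIn (↑(box d ((k + 1) * n)) : Set (Site d)) x y} := by
  classical
  set v : Site d := Pi.single 0 ((k * n : ℕ) : ℤ) with hv
  obtain ⟨x, hx, y, hy, hconn⟩ := hω
  set ω' : BondConfig (Site d) := BondConfig.relabel (sym2Equiv (Site.shift v)) ω with hω'
  let φ : openGraph ω ≃g openGraph ω' :=
    { toEquiv := Site.shift v
      map_rel_iff' := fun {a b} => openGraph_relabel_adj_iff (Site.shift v) ω a b }
  have hconn' : (openGraph ω').Reachable (x + v) (y + v) := by
    have h1 : (openGraph ω').Reachable (φ x) (φ y) := SimpleGraph.Reachable.map φ.toHom hconn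
    exact h1
  have hω'sub : ω' ⊆ (zdGraph d).edgeSet := by
    intro z hz
    rw [hω', BondConfig.mem_relabel_iff] at hz
    have hzE : (sym2Equiv (Site.shift v)).symm z ∈ (zdGraph d).edgeSet := hωE hz
    let ψ : zdGraph d ≃g zdGraph d :=
      { toEquiv := Site.shift v
        map_rel_iff' := fun {a b} => zdGraph_adj_shift_iff v a b }
    have key := sym2Equiv_mem_edgeSet_iff ψ ((sym2Equiv (Site.shift v)).symm z)
    have hz' : sym2Equiv ψ.toEquiv ((sym2Equiv (Site.shift v)).symm z) = z :=
      (sym2Equiv (Site.shift v)).apply_symm_apply z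
    rw [hz'] at key
    exact key.2 hzE
  have hle : openGraph ω' ≤ zdGraph d := openGraph_le_of_subset hω'sub
  obtain ⟨w⟩ := hconn'
  have hxn : x + v ∈ box d n := add_single_mul_mem_box_of_mem_leftFace hk hx
  have hxv : x + v ∈ box d ((k + 1) * n) := box_mono d (by nlinarith) hxn
  have hyv : y + v ∈ innerBoundary (zdGraph d) (box d ((k + 1) * n)) :=
    add_single_mul_mem_innerBoundary_of_mem_rightFace hy
  obtain ⟨b, hb, hu, hb', hreach⟩ :=
    exists_innerBoundary_reachable_of_walk_end hle (box d ((k + 1) * n)) w hxv (fun _ => hyv)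
  exact ⟨x + v, hxn, b, hb, hu, hb', hreach⟩

/-- **`P_p(Λ_n spanned, bulk b.c.) ≤ P_p(Λ_n ↔ ∂ⁱⁿΛ_{(k+1)n} in Λ_{(k+1)n})`** for `1 ≤ k ≤ 2` (translation by `k n e₁`). [cite: Aizenman1997, Thm. 4 (1)] -/
theorem real_bulkSpanning_le_real_boxCrossing [NeZero d] (p : unitInterval) (n : ℕ) {k : ℕ} (hk : k ≤ 2) :
    (bondPercolation (zdGraph d) p).real (bulkSpanning d n) ≤
      (bondPercolation (zdGraph d) p).real (boxCrossing d n ((k + 1) * n)) := by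
  set v : Site d := Pi.single 0 ((k * n : ℕ) : ℤ) with hv
  set E : Set (BondConfig (Site d)) := {ω | ∃ x ∈ box d n, ∃ y ∈ innerBoundary (zdGraph d) (box d ((k + 1) * n)),
        ω ∈ openConnIn (↑(box d ((k + 1) * n)) : Set (Site d)) x y} with hE
  have hae : ∀ᵐ ω ∂(bondPercolation (zdGraph d) p),
      ω ∈ bulkSpanning d n → ω ∈ BondConfig.relabel (sym2Equiv (Site.shift v)) ⁻¹' E := by
    have hsub : ∀ᵐ ω ∂(bondPercolation (zdGraph d) p), ω ⊆ (zdGraph d).edgeSet :=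
      ProbabilityTheory.setBernoulli_ae_subset
    filter_upwards [hsub] with ω hω hspan
    exact relabel_shift_mem_cross hk hω hspan
  calc (bondPercolation (zdGraph d) p).real (bulkSpanning d n)
      ≤ (bondPercolation (zdGraph d) p).real (BondConfig.relabel (sym2Equiv (Site.shift v)) ⁻¹' E) :=
        ENNReal.toReal_mono (measure_ne_top _ _) (measure_mono_ae hae)
    _ = (bondPercolation (zdGraph d) p).real E := bondPercolation_real_preimage_shift v p _
    _ ≤ (bondPercolation (zdGraph d) p).real (boxCrossing d n ((k + 1) * n)) := by
        refine DCT16.real_mono_of_forall_subset_edgeSet (zdGraph d) p fun ω hω h => ?_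
        obtain ⟨x, hx, y, hy, hpath⟩ := h
        have hr := reachable_within_of_pathIn hω (DCT16.pathIn_of_mem_openConnIn hpath)
        rw [boxCrossing_eq_linked, mem_linked_iff]
        refine ⟨y, Finset.mem_coe.2 hy, x, Finset.mem_coe.2 hx, ?_⟩
        rw [mem_inConn_iff]
        exact hr.symm

/-- **Above six dimensions the critical annuli of aspect two AND three are crossed with probability `→ 1`** (given (t-c) with `η = 0`):
`P_{p_c}(boxCrossing d n ((k+1)n)) → 1` for `k ∈ {1, 2}`.  Aspect three (`k = 2`) is the shape of BCKS's rectangles and is the largest aspect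
reachable from Aizenman's Thm. 4 (1) by a translation. [cite: Aizenman1997, Thm. 4 (1)] -/
theorem boxCrossing_tendsto_one_of_six_lt [NeZero d] (hd : 6 < d) (hτ : TwoPointBoundedRatio d) {k : ℕ} (hk : k ≤ 2) :
    Tendsto (fun n : ℕ => (bondPercolation (zdGraph d) (criticalProbI d)).real (boxCrossing d n ((k + 1) * n))) atTop (𝓝 1) :=
  tendsto_of_tendsto_of_tendsto_of_le_of_le (SpanningClustersAboveSix_holds.spanning_tendsto_one hd hτ) tendsto_const_nhds
    (fun n => real_bulkSpanning_le_real_boxCrossing _ n hk) fun _ => measureReal_le_one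

/-- **The crossing defect fails above six dimensions at aspects two and three**: for `d > 6` with `TwoPointBoundedRatio d`, `k ≤ 2` and every
`η > 0`, `¬ ScaleDefectAt d p_c ((k+1)·) η`. [cite: Aizenman1997, Thm. 4 (1)] -/
theorem not_scaleDefectAt_of_six_lt [NeZero d] (hd : 6 < d) (hτ : TwoPointBoundedRatio d) {k : ℕ} (hk : k ≤ 2) {η : ℝ} (hη : 0 < η) :
    ¬ ScaleDefectAt d (criticalProbI d) (fun m => (k + 1) * m) η := by
  intro h
  have ht := boxCrossing_tendsto_one_of_six_lt hd hτ hk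
  have hev : ∀ᶠ n : ℕ in atTop,
      (bondPercolation (zdGraph d) (criticalProbI d)).real (boxCrossing d n ((k + 1) * n)) ≤ 1 - η :=
    Filter.eventually_atTop.2 ⟨1, fun n hn => h n hn⟩
  have := le_of_tendsto ht hev
  linarith

/-- **`X_B(3)` fails above six dimensions**: `¬ ScaleDefectAt d p_c (3·) η` for every `η > 0` (`d > 6`, `TwoPointBoundedRatio d`). [cite: Aizenman1997, Thm. 4 (1)] -/
theorem not_scaleDefectAt_three_of_six_lt [NeZero d] (hd : 6 < d) (hτ : TwoPointBoundedRatio d) {η : ℝ} (hη : 0 < η) :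
    ¬ ScaleDefectAt d (criticalProbI d) (fun m => 3 * m) η := by
  have h := not_scaleDefectAt_of_six_lt hd hτ (k := 2) le_rfl hη
  simpa using h

/-- **`X_B(2)` fails above six dimensions**, in the lane's `ScaleDefectAt` vocabulary (the barrier file's `not_annulusCrossing_bounded_away_from_one` is the
`openConnIn` form). [cite: Aizenman1997, Thm. 4 (1)] -/
theorem not_scaleDefectAt_two_of_six_lt [NeZero d] (hd : 6 < d) (hτ : TwoPointBoundedRatio d) {η : ℝ} (hη : 0 < η) :
    ¬ ScaleDefectAt d (criticalProbI d) (fun m => 2 * m) η := by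
  have h := not_scaleDefectAt_of_six_lt hd hτ (k := 1) (by norm_num) hη
  simpa using h

end Summit.CriticalPhenomena.PercolationContinuityZ3.Theorems.Quant
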